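import Mathlib
import Literature.MathematicalPhysics.QuantumLattice.HubbardScaleReportCT
import HarnessLib

/-!
# `C²` calculus of the `C₄ᵥ` harmonics and termwise differentiation of weighted cosine series

Elementary real analysis behind the `C²` control of countertermed bands
`-2(cos p₁ + cos p₂) - μ - Σ κ_{mn} h_{mn}` (consumed by `ShellGeometryStability.lean`):

* Fréchet derivatives of the coordinate cosines/sines on `Fin 2 → ℝ` (chain rule through `proj i`);
* differentiability of the symmetrised harmonics `h_{mn}` (`TrigPolyC4v.harmonic`) with
  `Dh_{mn}(p) v = ∂₁h v₀ + ∂₂h v₁`, `∂ᵢh = TrigPolyC4v.harmonicGrad` (`HubbardScaleReportCT.lean`), and of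
  the two components of `harmonicGrad` with the explicit Hessian entries
  `∂₁∂₁h = -½(m² cos(m p₁)cos(n p₂) + n² cos(n p₁)cos(m p₂))`,
  `∂₁∂₂h = ½ m n (sin(m p₁)sin(n p₂) + sin(n p₁)sin(m p₂))`,
  `∂₂∂₂h = -½(n² cos(m p₁)cos(n p₂) + m² cos(n p₁)cos(m p₂))`, all bounded by `(1+m+n)²`;
* for a coefficient table `c : ℕ × ℕ → ℝ` with `Σ (1+q₁+q₂)² |c q| < ∞` and a family `φ q` with
  `|φ q|, |∂ᵢφ q| ≤ (1+q₁+q₂)²`: termwise differentiation of `p ↦ Σ' c q φ q p` (via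
  `hasFDerivAt_tsum`), its continuity, and the uniform bound
  `|Σ' c q φ q - Σ' c' q φ q| ≤ Σ' (1+q₁+q₂)² |c q - c' q|`.

Derivatives are recorded in the evaluated form `fderiv ℝ f p v = a v₀ + b v₁` (so that `partialD`
reads off `a`, `b`).  All statements are standard ([folklore]); no definitions are introduced.
-/

noncomputable section

namespace Literature.MathematicalPhysics.QuantumLattice

open _root_.Filter _root_.Topology Finset TrigPolyC4v
open scoped BigOperators

/-! ### Coordinate trigonometric functions on `ℝ²` -/

/-- `d/dx sin(m x) = m cos(m x)`. [folklore] -/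
theorem hasDerivAt_sin_nat_mul (m : ℕ) (x : ℝ) :
    HasDerivAt (fun x : ℝ => Real.sin (m * x)) (m * Real.cos (m * x)) x := by
  have h : HasDerivAt (fun x : ℝ => (m : ℝ) * x) (m : ℝ) x := by
    simpa using (hasDerivAt_id x).const_mul (m : ℝ)
  convert h.sin using 1
  ring

/-- `D(cos (m pᵢ)) = -m sin(m pᵢ) • projᵢ`. [folklore] -/
theorem hasFDerivAt_cos_nat_mul_coord (m : ℕ) (i : Fin 2) (p : Fin 2 → ℝ) :
    HasFDerivAt (fun p : Fin 2 → ℝ => Real.cos (m * p i))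
      ((-(m * Real.sin (m * p i))) • ContinuousLinearMap.proj (R := ℝ) (φ := fun _ : Fin 2 => ℝ) i) p := by
  have h1 : HasFDerivAt (fun f : Fin 2 → ℝ => f i)
      (ContinuousLinearMap.proj (R := ℝ) (φ := fun _ : Fin 2 => ℝ) i) p := hasFDerivAt_apply i p
  exact (hasDerivAt_cos_nat_mul m (p i)).comp_hasFDerivAt p h1

/-- `D(sin (m pᵢ)) = m cos(m pᵢ) • projᵢ`. [folklore] -/
theorem hasFDerivAt_sin_nat_mul_coord (m : ℕ) (i : Fin 2) (p : Fin 2 → ℝ) :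
    HasFDerivAt (fun p : Fin 2 → ℝ => Real.sin (m * p i))
      ((m * Real.cos (m * p i)) • ContinuousLinearMap.proj (R := ℝ) (φ := fun _ : Fin 2 => ℝ) i) p := by
  have h1 : HasFDerivAt (fun f : Fin 2 → ℝ => f i)
      (ContinuousLinearMap.proj (R := ℝ) (φ := fun _ : Fin 2 => ℝ) i) p := hasFDerivAt_apply i p
  exact (hasDerivAt_sin_nat_mul m (p i)).comp_hasFDerivAt p h1

/-- `D(cos pᵢ) = -sin pᵢ • projᵢ`. [folklore] -/
theorem hasFDerivAt_cos_coord (i : Fin 2) (p : Fin 2 → ℝ) :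
    HasFDerivAt (fun p : Fin 2 → ℝ => Real.cos (p i))
      ((-Real.sin (p i)) • ContinuousLinearMap.proj (R := ℝ) (φ := fun _ : Fin 2 => ℝ) i) p := by
  have h1 : HasFDerivAt (fun f : Fin 2 → ℝ => f i)
      (ContinuousLinearMap.proj (R := ℝ) (φ := fun _ : Fin 2 => ℝ) i) p := hasFDerivAt_apply i p
  exact (Real.hasDerivAt_cos (p i)).comp_hasFDerivAt p h1

/-- `D(sin pᵢ) = cos pᵢ • projᵢ`. [folklore] -/
theorem hasFDerivAt_sin_coord (i : Fin 2) (p : Fin 2 → ℝ) :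
    HasFDerivAt (fun p : Fin 2 → ℝ => Real.sin (p i))
      ((Real.cos (p i)) • ContinuousLinearMap.proj (R := ℝ) (φ := fun _ : Fin 2 => ℝ) i) p := by
  have h1 : HasFDerivAt (fun f : Fin 2 → ℝ => f i)
      (ContinuousLinearMap.proj (R := ℝ) (φ := fun _ : Fin 2 => ℝ) i) p := hasFDerivAt_apply i p
  exact (Real.hasDerivAt_sin (p i)).comp_hasFDerivAt p h1

/-- The operator norm of a derivative in evaluated form: if `L v = a v₀ + b v₁` then `‖L‖ ≤ |a| + |b|`
(sup norm on `ℝ²`). [folklore] -/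
theorem opNorm_le_of_apply_eq {L : (Fin 2 → ℝ) →L[ℝ] ℝ} {a b : ℝ} (h : ∀ v, L v = a * v 0 + b * v 1) :
    ‖L‖ ≤ |a| + |b| := by
  refine ContinuousLinearMap.opNorm_le_bound _ (by positivity) fun v => ?_
  rw [h, Real.norm_eq_abs]
  have h0 : |v 0| ≤ ‖v‖ := by simpa using norm_le_pi_norm v 0
  have h1 : |v 1| ≤ ‖v‖ := by simpa using norm_le_pi_norm v 1
  calc |a * v 0 + b * v 1| ≤ |a * v 0| + |b * v 1| := abs_add_le _ _
    _ = |a| * |v 0| + |b| * |v 1| := by rw [abs_mul, abs_mul]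
    _ ≤ |a| * ‖v‖ + |b| * ‖v‖ := by gcongr
    _ = (|a| + |b|) * ‖v‖ := by ring

/-! ### The harmonics: gradient and Hessian -/

/-- **The harmonics are differentiable with gradient `harmonicGrad`**:
`Dh_{mn}(p) v = ∂₁h_{mn}(p) v₀ + ∂₂h_{mn}(p) v₁`. [folklore] -/
theorem TrigPolyC4v.fderiv_harmonic (m n : ℕ) (p : Fin 2 → ℝ) :
    DifferentiableAt ℝ (fun p => harmonic m n p) p ∧ ∀ v, fderiv ℝ (fun p => harmonic m n p) p v =
      harmonicGrad m n p 0 * v 0 + harmonicGrad m n p 1 * v 1 := by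
  have h := ((((hasFDerivAt_cos_nat_mul_coord m 0 p).mul (hasFDerivAt_cos_nat_mul_coord n 1 p)).add
    ((hasFDerivAt_cos_nat_mul_coord n 0 p).mul (hasFDerivAt_cos_nat_mul_coord m 1 p))).mul_const (1 / 2))
  have h' := h.congr_of_eventuallyEq (f₁ := fun p => harmonic m n p) (Eventually.of_forall fun y => by
    simp only [harmonic, Pi.add_apply, Pi.mul_apply]; ring)
  refine ⟨h'.differentiableAt, fun v => ?_⟩
  rw [h'.fderiv]
  simp [harmonicGrad]; ring

/-- **Second derivatives of the harmonics, first row**: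
`D(∂₁h_{mn})(p) v = ∂₁∂₁h v₀ + ∂₁∂₂h v₁` with the explicit Hessian entries. [folklore] -/
theorem TrigPolyC4v.fderiv_harmonicGrad_fst (m n : ℕ) (p : Fin 2 → ℝ) :
    DifferentiableAt ℝ (fun p => harmonicGrad m n p 0) p ∧ ∀ v, fderiv ℝ (fun p => harmonicGrad m n p 0) p v =
      -((((m : ℝ) ^ 2 * Real.cos (m * p 0) * Real.cos (n * p 1) +
          (n : ℝ) ^ 2 * Real.cos (n * p 0) * Real.cos (m * p 1)) / 2)) * v 0 +
        (m : ℝ) * n * (Real.sin (m * p 0) * Real.sin (n * p 1) + Real.sin (n * p 0) * Real.sin (m * p 1)) / 2 *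
          v 1 := by
  have h := ((((hasFDerivAt_sin_nat_mul_coord m 0 p).mul (hasFDerivAt_cos_nat_mul_coord n 1 p)).const_mul
    (m : ℝ)).add (((hasFDerivAt_sin_nat_mul_coord n 0 p).mul (hasFDerivAt_cos_nat_mul_coord m 1 p)).const_mul
    (n : ℝ))).mul_const (-(1 / 2))
  have h' := h.congr_of_eventuallyEq (f₁ := fun p => harmonicGrad m n p 0) (Eventually.of_forall fun y => by
    simp only [harmonicGrad, Pi.add_apply, Pi.mul_apply, Matrix.cons_val_zero]; ring)
  refine ⟨h'.differentiableAt, fun v => ?_⟩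
  rw [h'.fderiv]
  simp; ring

/-- **Second derivatives of the harmonics, second row**:
`D(∂₂h_{mn})(p) v = ∂₁∂₂h v₀ + ∂₂∂₂h v₁` with the explicit Hessian entries. [folklore] -/
theorem TrigPolyC4v.fderiv_harmonicGrad_snd (m n : ℕ) (p : Fin 2 → ℝ) :
    DifferentiableAt ℝ (fun p => harmonicGrad m n p 1) p ∧ ∀ v, fderiv ℝ (fun p => harmonicGrad m n p 1) p v =
      (m : ℝ) * n * (Real.sin (m * p 0) * Real.sin (n * p 1) + Real.sin (n * p 0) * Real.sin (m * p 1)) / 2 *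
          v 0 +
        -((((n : ℝ) ^ 2 * Real.cos (m * p 0) * Real.cos (n * p 1) +
          (m : ℝ) ^ 2 * Real.cos (n * p 0) * Real.cos (m * p 1)) / 2)) * v 1 := by
  have h := ((((hasFDerivAt_cos_nat_mul_coord m 0 p).mul (hasFDerivAt_sin_nat_mul_coord n 1 p)).const_mul
    (n : ℝ)).add (((hasFDerivAt_cos_nat_mul_coord n 0 p).mul (hasFDerivAt_sin_nat_mul_coord m 1 p)).const_mul
    (m : ℝ))).mul_const (-(1 / 2))
  have h' := h.congr_of_eventuallyEq (f₁ := fun p => harmonicGrad m n p 1) (Eventually.of_forall fun y => by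
    simp only [harmonicGrad, Pi.add_apply, Pi.mul_apply, Matrix.cons_val_one, Matrix.cons_val_zero]; ring)
  refine ⟨h'.differentiableAt, fun v => ?_⟩
  rw [h'.fderiv]
  simp; ring

/-! ### Bounds `|∂^α h_{mn}| ≤ (1 + m + n)²` -/

/-- `|h_{mn}| ≤ (1+m+n)²`. [folklore] -/
theorem TrigPolyC4v.abs_harmonic_le_weight (q : ℕ × ℕ) (p : Fin 2 → ℝ) :
    |harmonic q.1 q.2 p| ≤ ((1 : ℝ) + q.1 + q.2) ^ 2 := by
  refine (abs_harmonic_le_one _ _ p).trans ?_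
  have : (0 : ℝ) ≤ q.1 + q.2 := by positivity
  nlinarith

/-- `|∂ᵢh_{mn}| ≤ (1+m+n)²`. [folklore] -/
theorem TrigPolyC4v.abs_harmonicGrad_le_weight (q : ℕ × ℕ) (p : Fin 2 → ℝ) (i : Fin 2) :
    |harmonicGrad q.1 q.2 p i| ≤ ((1 : ℝ) + q.1 + q.2) ^ 2 := by
  refine (abs_harmonicGrad_le _ _ p i).trans ?_
  have : (0 : ℝ) ≤ q.1 + q.2 := by positivity
  nlinarith

/-- An elementary bound: `|-(a² c₁ c₂ + b² c₃ c₄)/2| ≤ (1+a+b)²` for `|cᵢ| ≤ 1`. [folklore] -/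
theorem abs_sq_mul_mul_add_le (a b : ℕ) (c₁ c₂ c₃ c₄ : ℝ) (h₁ : |c₁| ≤ 1) (h₂ : |c₂| ≤ 1) (h₃ : |c₃| ≤ 1)
    (h₄ : |c₄| ≤ 1) : |-(((a : ℝ) ^ 2 * c₁ * c₂ + (b : ℝ) ^ 2 * c₃ * c₄) / 2)| ≤ ((1 : ℝ) + a + b) ^ 2 := by
  rw [abs_neg, abs_div, abs_two]
  have ha : |(a : ℝ) ^ 2 * c₁ * c₂| ≤ (a : ℝ) ^ 2 := by
    rw [abs_mul, abs_mul, abs_pow, Nat.abs_cast]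
    calc (a : ℝ) ^ 2 * |c₁| * |c₂| ≤ (a : ℝ) ^ 2 * 1 * 1 := by gcongr
      _ = (a : ℝ) ^ 2 := by ring
  have hb : |(b : ℝ) ^ 2 * c₃ * c₄| ≤ (b : ℝ) ^ 2 := by
    rw [abs_mul, abs_mul, abs_pow, Nat.abs_cast]
    calc (b : ℝ) ^ 2 * |c₃| * |c₄| ≤ (b : ℝ) ^ 2 * 1 * 1 := by gcongr
      _ = (b : ℝ) ^ 2 := by ring
  have := abs_add_le ((a : ℝ) ^ 2 * c₁ * c₂) ((b : ℝ) ^ 2 * c₃ * c₄)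
  rw [div_le_iff₀ (by norm_num : (0 : ℝ) < 2)]
  have ha0 : (0 : ℝ) ≤ a := Nat.cast_nonneg _
  have hb0 : (0 : ℝ) ≤ b := Nat.cast_nonneg _
  nlinarith

/-- `|∂₁∂₁h_{mn}| ≤ (1+m+n)²`. [folklore] -/
theorem TrigPolyC4v.abs_hxx_le_weight (q : ℕ × ℕ) (p : Fin 2 → ℝ) :
    |-((((q.1 : ℝ) ^ 2 * Real.cos (q.1 * p 0) * Real.cos (q.2 * p 1) +
        (q.2 : ℝ) ^ 2 * Real.cos (q.2 * p 0) * Real.cos (q.1 * p 1)) / 2))| ≤ ((1 : ℝ) + q.1 + q.2) ^ 2 :=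
  abs_sq_mul_mul_add_le _ _ _ _ _ _ (Real.abs_cos_le_one _) (Real.abs_cos_le_one _)
    (Real.abs_cos_le_one _) (Real.abs_cos_le_one _)

/-- `|∂₂∂₂h_{mn}| ≤ (1+m+n)²`. [folklore] -/
theorem TrigPolyC4v.abs_hyy_le_weight (q : ℕ × ℕ) (p : Fin 2 → ℝ) :
    |-((((q.2 : ℝ) ^ 2 * Real.cos (q.1 * p 0) * Real.cos (q.2 * p 1) +
        (q.1 : ℝ) ^ 2 * Real.cos (q.2 * p 0) * Real.cos (q.1 * p 1)) / 2))| ≤ ((1 : ℝ) + q.1 + q.2) ^ 2 := by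
  have := abs_sq_mul_mul_add_le q.2 q.1 _ _ _ _ (Real.abs_cos_le_one (q.1 * p 0))
    (Real.abs_cos_le_one (q.2 * p 1)) (Real.abs_cos_le_one (q.2 * p 0)) (Real.abs_cos_le_one (q.1 * p 1))
  calc _ ≤ ((1 : ℝ) + q.2 + q.1) ^ 2 := this
    _ = _ := by ring

/-- `|∂₁∂₂h_{mn}| ≤ (1+m+n)²`. [folklore] -/
theorem TrigPolyC4v.abs_hxy_le_weight (q : ℕ × ℕ) (p : Fin 2 → ℝ) :
    |(q.1 : ℝ) * q.2 * (Real.sin (q.1 * p 0) * Real.sin (q.2 * p 1) + Real.sin (q.2 * p 0) * Real.sin (q.1 * p 1)) /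
        2| ≤ ((1 : ℝ) + q.1 + q.2) ^ 2 := by
  have h1 : |Real.sin (q.1 * p 0) * Real.sin (q.2 * p 1)| ≤ 1 := by
    rw [abs_mul]; exact mul_le_one₀ (Real.abs_sin_le_one _) (abs_nonneg _) (Real.abs_sin_le_one _)
  have h2 : |Real.sin (q.2 * p 0) * Real.sin (q.1 * p 1)| ≤ 1 := by
    rw [abs_mul]; exact mul_le_one₀ (Real.abs_sin_le_one _) (abs_nonneg _) (Real.abs_sin_le_one _)
  have h12 := (abs_add_le _ _).trans (add_le_add h1 h2)
  rw [abs_div, abs_two, abs_mul, abs_mul, Nat.abs_cast, Nat.abs_cast,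
    div_le_iff₀ (by norm_num : (0:ℝ) < 2)]
  have ha0 : (0 : ℝ) ≤ q.1 := Nat.cast_nonneg _
  have hb0 : (0 : ℝ) ≤ q.2 := Nat.cast_nonneg _
  have hab : (0 : ℝ) ≤ (q.1 : ℝ) * q.2 := mul_nonneg ha0 hb0
  calc (q.1 : ℝ) * q.2 * |Real.sin (q.1 * p 0) * Real.sin (q.2 * p 1) +
        Real.sin (q.2 * p 0) * Real.sin (q.1 * p 1)|
      ≤ (q.1 : ℝ) * q.2 * 2 := by gcongr; exact h12.trans (by norm_num)
    _ ≤ _ := by nlinarith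

/-! ### Weighted cosine-type series: termwise differentiation, continuity, uniform difference bound -/

/-- A table `c` with `Σ (1+m+n)²|c| < ∞` against a family bounded by the weight is summable. [folklore] -/
theorem summable_mul_of_abs_le_weight {c : ℕ × ℕ → ℝ}
    (hc : Summable fun q : ℕ × ℕ => ((1 : ℝ) + q.1 + q.2) ^ 2 * |c q|)
    {φ : ℕ × ℕ → ℝ} (h : ∀ q, |φ q| ≤ ((1 : ℝ) + q.1 + q.2) ^ 2) : Summable fun q => c q * φ q :=
  Summable.of_norm_bounded hc fun q => by
    rw [Real.norm_eq_abs, abs_mul, mul_comm]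
    exact mul_le_mul_of_nonneg_right (h q) (abs_nonneg _)

/-- The weighted norm of a difference of two tables is summable. [folklore] -/
theorem summable_weight_mul_abs_sub {c c' : ℕ × ℕ → ℝ}
    (hc : Summable fun q : ℕ × ℕ => ((1 : ℝ) + q.1 + q.2) ^ 2 * |c q|)
    (hc' : Summable fun q : ℕ × ℕ => ((1 : ℝ) + q.1 + q.2) ^ 2 * |c' q|) :
    Summable fun q : ℕ × ℕ => ((1 : ℝ) + q.1 + q.2) ^ 2 * |c q - c' q| :=
  (hc.add hc').of_nonneg_of_le (fun q => by positivity) fun q => by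
    rw [← mul_add]; exact mul_le_mul_of_nonneg_left (abs_sub _ _) (by positivity)

/-- **Termwise differentiation of a weighted cosine-type series**: if every `φ q` is differentiable with
`D(φ q)(p) v = φ₀ q p v₀ + φ₁ q p v₁` and `|φ q|, |φ₀ q|, |φ₁ q| ≤ (1+q₁+q₂)²`, then for a table with
`Σ (1+q₁+q₂)²|c q| < ∞` the series `p ↦ Σ' c q φ q p` is differentiable with the termwise derivative
`v ↦ (Σ' c q φ₀ q p) v₀ + (Σ' c q φ₁ q p) v₁`. [folklore] -/
theorem fderiv_tsum_mul_weight {c : ℕ × ℕ → ℝ}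
    (hc : Summable fun q : ℕ × ℕ => ((1 : ℝ) + q.1 + q.2) ^ 2 * |c q|)
    {φ φ₀ φ₁ : ℕ × ℕ → (Fin 2 → ℝ) → ℝ} (hd : ∀ q p, DifferentiableAt ℝ (φ q) p)
    (hφ : ∀ q p v, fderiv ℝ (φ q) p v = φ₀ q p * v 0 + φ₁ q p * v 1)
    (hb : ∀ q p, |φ q p| ≤ ((1 : ℝ) + q.1 + q.2) ^ 2) (hb₀ : ∀ q p, |φ₀ q p| ≤ ((1 : ℝ) + q.1 + q.2) ^ 2)
    (hb₁ : ∀ q p, |φ₁ q p| ≤ ((1 : ℝ) + q.1 + q.2) ^ 2) (p : Fin 2 → ℝ) :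
    DifferentiableAt ℝ (fun p => ∑' q, c q * φ q p) p ∧ ∀ v, fderiv ℝ (fun p => ∑' q, c q * φ q p) p v =
      (∑' q, c q * φ₀ q p) * v 0 + (∑' q, c q * φ₁ q p) * v 1 := by
  have hn : ∀ q p, ‖c q • fderiv ℝ (φ q) p‖ ≤ 2 * (((1 : ℝ) + q.1 + q.2) ^ 2 * |c q|) := fun q p => by
    rw [norm_smul, Real.norm_eq_abs]
    calc |c q| * ‖fderiv ℝ (φ q) p‖ ≤ |c q| * (((1 : ℝ) + q.1 + q.2) ^ 2 + ((1 : ℝ) + q.1 + q.2) ^ 2) :=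
          mul_le_mul_of_nonneg_left ((opNorm_le_of_apply_eq (hφ q p)).trans
            (add_le_add (hb₀ q p) (hb₁ q p))) (abs_nonneg _)
      _ = _ := by ring
  have hA := hasFDerivAt_tsum (u := fun q : ℕ × ℕ => 2 * (((1 : ℝ) + q.1 + q.2) ^ 2 * |c q|)) (hc.mul_left 2)
    (f := fun q p => c q * φ q p) (f' := fun q p => c q • fderiv ℝ (φ q) p) (x₀ := p)
    (fun q p => (hd q p).hasFDerivAt.const_mul (c q)) hn (summable_mul_of_abs_le_weight hc fun q => hb q p) p
  refine ⟨hA.differentiableAt, fun v => ?_⟩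
  have hT : Summable fun q => c q • fderiv ℝ (φ q) p := Summable.of_norm_bounded (hc.mul_left 2) fun q => hn q p
  rw [hA.fderiv, show (∑' q, c q • fderiv ℝ (φ q) p) v = ∑' q, (c q • fderiv ℝ (φ q) p) v by
    simpa only [ContinuousLinearMap.apply_apply] using (ContinuousLinearMap.apply ℝ ℝ v).map_tsum hT]
  simp only [FunLike.coe_smul, Pi.smul_apply, smul_eq_mul, hφ]
  have hs₀ := (summable_mul_of_abs_le_weight hc fun q => hb₀ q p).mul_right (v 0)
  have hs₁ := (summable_mul_of_abs_le_weight hc fun q => hb₁ q p).mul_right (v 1)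
  rw [← tsum_mul_right, ← tsum_mul_right, ← hs₀.tsum_add hs₁]
  exact tsum_congr fun q => by ring

/-- **Continuity of a weighted cosine-type series** (uniform convergence). [folklore] -/
theorem continuous_tsum_mul_weight {c : ℕ × ℕ → ℝ}
    (hc : Summable fun q : ℕ × ℕ => ((1 : ℝ) + q.1 + q.2) ^ 2 * |c q|)
    {φ : ℕ × ℕ → (Fin 2 → ℝ) → ℝ} (hφ : ∀ q, Continuous (φ q))
    (hb : ∀ q p, |φ q p| ≤ ((1 : ℝ) + q.1 + q.2) ^ 2) : Continuous fun p => ∑' q, c q * φ q p :=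
  continuous_tsum (fun q => continuous_const.mul (hφ q)) hc fun q p => by
    rw [Real.norm_eq_abs, abs_mul, mul_comm]
    exact mul_le_mul_of_nonneg_right (hb q p) (abs_nonneg _)

/-- **Uniform difference bound**: two weighted series against the same bounded family differ by at
most the weighted `ℓ¹` distance of their tables (uniformly in the family). [folklore] -/
theorem abs_tsum_mul_sub_le_weight {c c' : ℕ × ℕ → ℝ}
    (hc : Summable fun q : ℕ × ℕ => ((1 : ℝ) + q.1 + q.2) ^ 2 * |c q|)
    (hc' : Summable fun q : ℕ × ℕ => ((1 : ℝ) + q.1 + q.2) ^ 2 * |c' q|) {φ : ℕ × ℕ → ℝ}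
    (hb : ∀ q, |φ q| ≤ ((1 : ℝ) + q.1 + q.2) ^ 2) :
    |∑' q, c q * φ q - ∑' q, c' q * φ q| ≤ ∑' q : ℕ × ℕ, ((1 : ℝ) + q.1 + q.2) ^ 2 * |c q - c' q| := by
  have hd := summable_weight_mul_abs_sub hc hc'
  have habs : ∀ q : ℕ × ℕ, |c q * φ q - c' q * φ q| ≤ ((1 : ℝ) + q.1 + q.2) ^ 2 * |c q - c' q| := fun q => by
    rw [← sub_mul, abs_mul, mul_comm]
    exact mul_le_mul_of_nonneg_right (hb q) (abs_nonneg _)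
  have hs : Summable fun q => |c q * φ q - c' q * φ q| :=
    hd.of_nonneg_of_le (fun q => abs_nonneg _) habs
  rw [← (summable_mul_of_abs_le_weight hc hb).tsum_sub (summable_mul_of_abs_le_weight hc' hb)]
  calc |∑' q, (c q * φ q - c' q * φ q)| ≤ ∑' q, |c q * φ q - c' q * φ q| := by
        have := norm_tsum_le_tsum_norm (f := fun q => c q * φ q - c' q * φ q)
          (by simpa [Real.norm_eq_abs] using hs)
        simpa [Real.norm_eq_abs] using this
    _ ≤ _ := hs.tsum_le_tsum habs hd

end Literature.MathematicalPhysics.QuantumLattice
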